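import Summits.AnomalousDissipation.AnomalousDissipation.Theses.VirtualDissipation
import Summits.AnomalousDissipation.AnomalousDissipation.Theorems.LightSteadyStatesGP.Negative.TrivialWitnesses
import Literature.Analysis.FunctionSpaces.TorusFluidGlueProofs

/-!
# Negative lemmas for crux `LightSteadyStatesGP` (stmt-AnomalousDissipation-15151, route VirtualDissipation) —
# the ν-uniform energy FLOOR of the steady states of `f_GP`, and the level of the crux cannot be lowered
# below `3/(4π)` (refuter cdisprove, cycle 1, 2026-08-17)

The crux asks for classical steady states `(u_j, p_j)` of `NS_{ν_j}(f_GP)` along `ν_j → 0` in `(0,1]`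
with `∫ u_j = 0` and `∫ |u_j|² ≤ 2` (LIGHT at LEVEL `2`).  This file proves, sorry-free:

* `energy_identity` — `ν ‖∇u‖₂² = ∫⟪f_GP, u⟫` at every classical steady state (any `ν`, any mean);
* `reproduction_identity` — testing the momentum equation against the force itself:
  `3/2 = 4π²ν ∫⟪f_GP, u⟫ − ∫⟪Df_GP(x) u(x), u(x)⟫` (uses `Δ f_GP = −4π² f_GP`, `∫|f_GP|² = 3/2`,
  `∫⟪∇p, f_GP⟫ = 0`, antisymmetry of the trilinear form);
* `floor_sharp` — `3/2 ≤ 2π ∫|u|² + 4π²ν ∫⟪f_GP,u⟫` (the pointwise strain bound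
  `⟪Df_GP(x)v, v⟫ ≥ −2π|v|²`), equivalently `3/2 ≤ 2π ∫|u|² + 4π²ν·(ν‖∇u‖₂²)` (`floor_dissipation`);
* `floor` — the closed ν-uniform form `3/2 ≤ (2π + 2π²ν) ∫|u|² + 3π²ν` (`ν ≥ 0`), and
  `energyFloorGP_census` — the signature `stub_energyFloorGP` of the crux census
  (`Cruxes/LightSteadyStatesGP/CensusSketch.lean`) verbatim: `3/2 ≤ (2π + ν/2)∫|u|² + 12π⁴ν`;
* `work_sq_le` — `(∫⟪f_GP,u⟫)² ≤ (3/2)∫|u|²`, hence `dissipation_sq_le_of_light`: a LIGHT steady state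
  dissipates at most `√3`: `(ν‖∇u‖₂²)² ≤ 3`;
* **`not_lightSteadyStatesGP_atLevel_of_lt`** — the natural strengthening "lighter than `3/(4π) ≈ 0.2387`"
  is FALSE: the shape of the crux with its level `2` replaced by any `E < 3/(4π)` (inline, verbatim
  otherwise) has no witnesses (in particular none at level `1/5`, `not_lightSteadyStatesGP_atLevel_fifth`);
  `level_ge_of_lightSteadyStatesGP_atLevel`: any level at which the shape holds is `≥ 3/(4π)`.  The
  mean-zero clause is NOT used: the floor binds every classical steady state;
* `witness_window`, `lightSteadyStatesGP_witness_shell` — what the crux's own witnesses must look like.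

Reading for provers/planners.  The pinned level `2` sits a factor `8π/3 ≈ 8.4` above the only rigorous
floor; every witness slice lives in the energy shell `(3/2 − 3π²ν_j)/(2π + 2π²ν_j) ≤ ∫|u_j|² ≤ 2` with
dissipation `ν_j‖∇u_j‖₂² ≤ √3`, and by `reproduction_identity` its strain–energy correlation
`−∫⟪Df_GP u_j, u_j⟫ = 3/2 − 4π²ν_j ε_j → 3/2` is pinned in the limit: light witnesses must keep an `O(1)`
alignment with the compressive directions of `∇f_GP` while `‖∇u_j‖₂² = ε_j/ν_j → ∞`.  Nothing here
bounds the energy from ABOVE uniformly in `ν` (the a-priori ceiling is `3/(32π⁴ν²)`, file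
`AprioriRegime.lean`); that gap is the crux.

Tools reused: `Torus.IsClassicalNSSolutionOn.energy_balance_holds`, `Torus.integral_inner_laplacian_comm`,
`Torus.integral_inner_convect_eq_neg`, `Torus.integral_inner_gradient_eq_zero_of_isDivFree`, the landed
`gpForce` bookkeeping (`gpForce_fderiv_apply`, `gpForce_inner_fderiv_apply_ge`, `gpForce_integral_inner_self`,
`StubHeadCoefficients.integral_norm_sq_gpForce`, `TrivialWitnesses.laplacian_gpForce`, `stub_gpAdmissible`).
-/

set_option linter.dupNamespace false

noncomputable section

open MeasureTheory Set Filter Topology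
open scoped InnerProductSpace RealInnerProductSpace

namespace Summit.AnomalousDissipation.AnomalousDissipation.Theorems.LightSteadyStatesGP.Negative.LevelFloor

open Literature.Analysis.FunctionSpaces Literature.Analysis.FluidPDE
open Summit.AnomalousDissipation.AnomalousDissipation.Theorems.EnsembleRigidity
open Summit.AnomalousDissipation.AnomalousDissipation.Theorems.EnsembleRigidity.GPStatisticalRigidity
open Summit.AnomalousDissipation.AnomalousDissipation.Theorems.EnsembleRigidity.GPMeanBoundedFamily

/-! ## §1 Two identities at a classical steady state of `NS_ν(f_GP)` -/

/-- **Steady energy identity** `ν ‖∇u‖₂² = ∫⟪f_GP, u⟫` for a classical steady state of `NS_ν(f_GP)`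
(the kinetic energy of the constant path is constant; its derivative is `−ν‖∇u‖² + ∫⟪f,u⟫`,
`Torus.IsClassicalNSSolutionOn.energy_balance_holds`).  Any `ν`, any mean. [folklore] -/
theorem energy_identity {ν : ℝ} {u : UnitAddTorus (Fin 3) → EuclideanSpace ℝ (Fin 3)}
    {p : UnitAddTorus (Fin 3) → ℝ}
    (h : Torus.IsClassicalNSSolutionOn Set.univ ν (fun _ => gpForce) (fun _ => u) (fun _ => p)) :
    ν * Torus.gradNormSq u = ∫ x, ⟪gpForce x, u x⟫_ℝ := by
  -- pattern from Theorems/CoherentStatesSteadyNegTameOffThinSets.lean (`steady_energy_identity`)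
  have hd := Torus.IsClassicalNSSolutionOn.energy_balance_holds h convex_univ (Set.mem_univ (0 : ℝ))
  rw [hasDerivWithinAt_univ] at hd
  have h0 : HasDerivAt (fun _ : ℝ => Torus.kineticEnergy u) (0 : ℝ) (0 : ℝ) := hasDerivAt_const _ _
  have := h0.unique hd
  linarith

/-- **Reproduction identity** (the momentum equation tested against the force itself):
`3/2 = 4π²ν ∫⟪f_GP, u⟫ − ∫⟪Df_GP(x) u(x), u(x)⟫` at every classical steady state of `NS_ν(f_GP)`
(`∫⟪νΔu, f⟫ = ν∫⟪u, Δf⟫ = −4π²ν∫⟪u,f⟫`, `∫⟪∇p, f⟫ = 0`, `∫⟪(u·∇)u, f⟫ = −∫⟪u, (u·∇)f⟫`,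
`∫|f_GP|² = 3/2`).  Any `ν`, any mean. [folklore] -/
theorem reproduction_identity {ν : ℝ} {u : UnitAddTorus (Fin 3) → EuclideanSpace ℝ (Fin 3)}
    {p : UnitAddTorus (Fin 3) → ℝ}
    (h : Torus.IsClassicalNSSolutionOn Set.univ ν (fun _ => gpForce) (fun _ => u) (fun _ => p)) :
    (3 : ℝ) / 2 = 4 * Real.pi ^ 2 * ν * (∫ x, ⟪gpForce x, u x⟫_ℝ) -
      ∫ x, ⟪Torus.fderiv gpForce x (u x), u x⟫_ℝ := by
  obtain ⟨hfs, hfd, -⟩ : Torus.IsSmooth gpForce ∧ Torus.IsDivFree gpForce ∧ Torus.HasZeroMean gpForce :=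
    SteadyStatesLoudBounded.GpAdmissible.stub_gpAdmissible
  have hu : Torus.IsSmooth u := h.smooth_velocity.isSmooth_slice (Set.mem_univ (0 : ℝ))
  have hp : Torus.IsSmooth p := h.smooth_pressure.isSmooth_slice (Set.mem_univ (0 : ℝ))
  have hdiv : Torus.IsDivFree u := h.divFree 0 (Set.mem_univ _)
  -- the momentum equation of the constant path, pointwise
  have hpt : ∀ x, Torus.convect u u x = ν • Torus.laplacian u x - Torus.gradient p x + gpForce x := by
    intro x
    have hm := h.momentum 0 (Set.mem_univ _) x
    have h0 : Torus.timeDerivWithin Set.univ (fun _ : ℝ => u) 0 x = 0 := by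
      simp [Torus.timeDerivWithin]
    rw [h0, zero_add] at hm
    exact hm
  have iL : Integrable (fun x => ⟪ν • Torus.laplacian u x, gpForce x⟫_ℝ) volume :=
    ((hu.laplacian.smul ν).inner hfs).integrable
  have iP : Integrable (fun x => ⟪Torus.gradient p x, gpForce x⟫_ℝ) volume :=
    (hp.gradient.inner hfs).integrable
  have iF : Integrable (fun x => ⟪gpForce x, gpForce x⟫_ℝ) volume := (hfs.inner hfs).integrable
  -- the four terms
  have hC : ∫ x, ⟪Torus.convect u u x, gpForce x⟫_ℝ = -∫ x, ⟪Torus.fderiv gpForce x (u x), u x⟫_ℝ := by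
    rw [Torus.integral_inner_convect_eq_neg hu hdiv hu hfs]
    congr 1
    exact integral_congr_ae (ae_of_all _ fun x => real_inner_comm _ _)
  have hLap : ∫ x, ⟪ν • Torus.laplacian u x, gpForce x⟫_ℝ =
      -(4 * Real.pi ^ 2) * ν * ∫ x, ⟪gpForce x, u x⟫_ℝ := by
    simp_rw [real_inner_smul_left]
    rw [integral_const_mul, Torus.integral_inner_laplacian_comm hu hfs]
    simp_rw [TrivialWitnesses.laplacian_gpForce, real_inner_smul_right]
    rw [integral_const_mul]
    have e : ∫ x, ⟪u x, gpForce x⟫_ℝ = ∫ x, ⟪gpForce x, u x⟫_ℝ :=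
      integral_congr_ae (ae_of_all _ fun x => real_inner_comm _ _)
    rw [e]
    ring
  have hP0 : ∫ x, ⟪Torus.gradient p x, gpForce x⟫_ℝ = 0 :=
    Torus.integral_inner_gradient_eq_zero_of_isDivFree hfs hp hfd
  have hFF : ∫ x, ⟪gpForce x, gpForce x⟫_ℝ = 3 / 2 := gpForce_integral_inner_self
  have iLP : Integrable (fun x => ⟪ν • Torus.laplacian u x, gpForce x⟫_ℝ - ⟪Torus.gradient p x, gpForce x⟫_ℝ)
      volume := iL.sub iP
  have key : ∫ x, ⟪Torus.convect u u x, gpForce x⟫_ℝ =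
      ∫ x, ⟪ν • Torus.laplacian u x - Torus.gradient p x + gpForce x, gpForce x⟫_ℝ := by
    simp_rw [hpt]
  rw [hC] at key
  simp_rw [inner_add_left, inner_sub_left] at key
  rw [integral_add iLP iF, integral_sub iL iP, hLap, hP0, hFF] at key
  linarith

/-! ## §2 The floor -/

/-- The integrated strain bound `−2π ∫|u|² ≤ ∫⟪Df_GP(x) u(x), u(x)⟫` (pointwise
`gpForce_inner_fderiv_apply_ge`). [folklore] -/
theorem integral_inner_fderiv_gpForce_ge {u : UnitAddTorus (Fin 3) → EuclideanSpace ℝ (Fin 3)}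
    (hu : Torus.IsSmooth u) :
    -(2 * Real.pi) * ∫ x, ‖u x‖ ^ 2 ≤ ∫ x, ⟪Torus.fderiv gpForce x (u x), u x⟫_ℝ := by
  rw [← integral_const_mul]
  exact integral_mono (hu.norm_sq.integrable.const_mul _)
    ((hu.convect gpForce_isSmooth).inner hu).integrable fun x => gpForce_inner_fderiv_apply_ge x (u x)

/-- **Sharp floor**: `3/2 ≤ 2π ∫|u|² + 4π²ν ∫⟪f_GP, u⟫` at every classical steady state of `NS_ν(f_GP)`
(any `ν`, any mean). [folklore] -/
theorem floor_sharp {ν : ℝ} {u : UnitAddTorus (Fin 3) → EuclideanSpace ℝ (Fin 3)}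
    {p : UnitAddTorus (Fin 3) → ℝ}
    (h : Torus.IsClassicalNSSolutionOn Set.univ ν (fun _ => gpForce) (fun _ => u) (fun _ => p)) :
    (3 : ℝ) / 2 ≤ 2 * Real.pi * (∫ x, ‖u x‖ ^ 2) + 4 * Real.pi ^ 2 * ν * ∫ x, ⟪gpForce x, u x⟫_ℝ := by
  have h1 := reproduction_identity h
  have h2 := integral_inner_fderiv_gpForce_ge (h.smooth_velocity.isSmooth_slice (Set.mem_univ (0 : ℝ)))
  linarith

/-- **Floor in terms of the dissipation** `ε = ν‖∇u‖₂²`: `3/2 ≤ 2π ∫|u|² + 4π²ν ε`. [folklore] -/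
theorem floor_dissipation {ν : ℝ} {u : UnitAddTorus (Fin 3) → EuclideanSpace ℝ (Fin 3)}
    {p : UnitAddTorus (Fin 3) → ℝ}
    (h : Torus.IsClassicalNSSolutionOn Set.univ ν (fun _ => gpForce) (fun _ => u) (fun _ => p)) :
    (3 : ℝ) / 2 ≤ 2 * Real.pi * (∫ x, ‖u x‖ ^ 2) + 4 * Real.pi ^ 2 * ν * (ν * Torus.gradNormSq u) := by
  rw [energy_identity h]
  exact floor_sharp h

/-- Pointwise-Young bookkeeping: `2 ∫⟪f_GP, u⟫ ≤ 3/2 + ∫|u|²` and `2·4π² ∫⟪f_GP,u⟫ ≤ 24π⁴ + ∫|u|²`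
for smooth `u` (`2⟪a,b⟫ ≤ |a|² + |b|²`, `∫|f_GP|² = 3/2`). [folklore] -/
theorem two_mul_work_le {u : UnitAddTorus (Fin 3) → EuclideanSpace ℝ (Fin 3)} (hu : Torus.IsSmooth u)
    (t : ℝ) :
    2 * t * ∫ x, ⟪gpForce x, u x⟫_ℝ ≤ t ^ 2 * (3 / 2) + ∫ x, ‖u x‖ ^ 2 := by
  have hfs : Torus.IsSmooth gpForce := gpForce_isSmooth
  have hpt : ∀ x, 2 * t * ⟪gpForce x, u x⟫_ℝ ≤ t ^ 2 * ‖gpForce x‖ ^ 2 + ‖u x‖ ^ 2 := by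
    intro x
    have h0 : 0 ≤ ‖t • gpForce x - u x‖ ^ 2 := sq_nonneg _
    rw [norm_sub_sq_real, real_inner_smul_left, norm_smul, mul_pow, Real.norm_eq_abs, sq_abs] at h0
    linarith
  have i1 : Integrable (fun x => 2 * t * ⟪gpForce x, u x⟫_ℝ) volume := (hfs.inner hu).integrable.const_mul _
  have i2 : Integrable (fun x => t ^ 2 * ‖gpForce x‖ ^ 2 + ‖u x‖ ^ 2) volume :=
    (hfs.norm_sq.integrable.const_mul _).add hu.norm_sq.integrable
  have h := integral_mono i1 i2 hpt
  rw [integral_const_mul, integral_add (hfs.norm_sq.integrable.const_mul _) hu.norm_sq.integrable,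
    integral_const_mul, StubHeadCoefficients.integral_norm_sq_gpForce] at h
  exact h

/-- **ν-uniform energy floor, closed form**: for `ν ≥ 0`, every classical steady state of `NS_ν(f_GP)`
has `3/2 ≤ (2π + 2π²ν) ∫|u|² + 3π²ν`, i.e. `∫|u|² ≥ (3/2 − 3π²ν)/(2π + 2π²ν) → 3/(4π) ≈ 0.2387`.
[folklore] -/
theorem floor {ν : ℝ} (hν : 0 ≤ ν) {u : UnitAddTorus (Fin 3) → EuclideanSpace ℝ (Fin 3)}
    {p : UnitAddTorus (Fin 3) → ℝ}
    (h : Torus.IsClassicalNSSolutionOn Set.univ ν (fun _ => gpForce) (fun _ => u) (fun _ => p)) :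
    (3 : ℝ) / 2 ≤ (2 * Real.pi + 2 * Real.pi ^ 2 * ν) * (∫ x, ‖u x‖ ^ 2) + 3 * Real.pi ^ 2 * ν := by
  have h1 := floor_sharp h
  have hY := two_mul_work_le (h.smooth_velocity.isSmooth_slice (Set.mem_univ (0 : ℝ))) 1
  have h2 : 0 ≤ 2 * Real.pi ^ 2 * ν := by positivity
  nlinarith [mul_le_mul_of_nonneg_left hY h2]

/-- The census signature `stub_energyFloorGP` of `Cruxes/LightSteadyStatesGP/CensusSketch.lean`, verbatim
(Young applied to `ν⟪u, 4π²f_GP⟫` instead: `4π²ν∫⟪f,u⟫ ≤ (ν/2)∫|u|² + 12π⁴ν`). [folklore] -/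
theorem energyFloorGP_census :
    ∀ (ν : ℝ) (u : UnitAddTorus (Fin 3) → EuclideanSpace ℝ (Fin 3)) (p : UnitAddTorus (Fin 3) → ℝ),
      0 ≤ ν → Torus.IsClassicalNSSolutionOn Set.univ ν (fun _ => fun x : UnitAddTorus (Fin 3) => (Literature.Analysis.FluidPDE.Torus.stokesMode (Pi.single (2 : Fin 3) (1 : ℤ)) (EuclideanSpace.single (0 : Fin 3) (1 : ℝ)) false x + Literature.Analysis.FluidPDE.Torus.stokesMode (Pi.single (0 : Fin 3) (1 : ℤ)) (EuclideanSpace.single (1 : Fin 3) (1 : ℝ)) false x + Literature.Analysis.FluidPDE.Torus.stokesMode (Pi.single (1 : Fin 3) (1 : ℤ)) (EuclideanSpace.single (2 : Fin 3) (1 : ℝ)) false x : EuclideanSpace ℝ (Fin 3))) (fun _ => u) (fun _ => p) →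
        (3 : ℝ) / 2 ≤ (2 * Real.pi + ν / 2) * (∫ x, ‖u x‖ ^ 2) + 12 * Real.pi ^ 4 * ν := by
  intro ν u p hν h
  have h1 := floor_sharp h
  have hY := two_mul_work_le (h.smooth_velocity.isSmooth_slice (Set.mem_univ (0 : ℝ))) (4 * Real.pi ^ 2)
  -- `2·4π²∫⟪f,u⟫ ≤ 16π⁴·3/2 + ∫|u|² = 24π⁴ + ∫|u|²`, times `ν/2 ≥ 0`
  have h2 : 0 ≤ ν / 2 := by positivity
  nlinarith [mul_le_mul_of_nonneg_left hY h2]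

/-! ## §3 Work and dissipation of LIGHT states are bounded -/

/-- **Cauchy–Schwarz for the work**: `(∫⟪f_GP, u⟫)² ≤ (3/2) ∫|u|²` (discriminant of
`t ↦ ∫|t f_GP − u|² ≥ 0`). [folklore] -/
theorem work_sq_le {u : UnitAddTorus (Fin 3) → EuclideanSpace ℝ (Fin 3)} (hu : Torus.IsSmooth u) :
    (∫ x, ⟪gpForce x, u x⟫_ℝ) ^ 2 ≤ 3 / 2 * ∫ x, ‖u x‖ ^ 2 := by
  set W := ∫ x, ⟪gpForce x, u x⟫_ℝ with hW
  have h := two_mul_work_le hu (2 * W / 3)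
  nlinarith [h]

/-- **A light steady state dissipates at most `√3`**: if `∫|u|² ≤ 2` then `(ν‖∇u‖₂²)² ≤ 3`
(`ν‖∇u‖² = ∫⟪f,u⟫`, Cauchy–Schwarz, `∫|f_GP|² = 3/2`). [folklore] -/
theorem dissipation_sq_le_of_light {ν : ℝ} {u : UnitAddTorus (Fin 3) → EuclideanSpace ℝ (Fin 3)}
    {p : UnitAddTorus (Fin 3) → ℝ}
    (h : Torus.IsClassicalNSSolutionOn Set.univ ν (fun _ => gpForce) (fun _ => u) (fun _ => p))
    (hE : ∫ x, ‖u x‖ ^ 2 ≤ 2) :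
    (ν * Torus.gradNormSq u) ^ 2 ≤ 3 := by
  rw [energy_identity h]
  have h1 := work_sq_le (h.smooth_velocity.isSmooth_slice (Set.mem_univ (0 : ℝ)))
  nlinarith [h1, hE]

/-! ## §4 The level of the crux: no level below `3/(4π)`

`LightSteadyStatesGP` is, character for character, the level-`2` instance of the shape
"`∃ ν_j → 0` in `(0,1]`, classical steady states of `NS_{ν_j}(f_GP)`, mean zero, `∫|u_j|² ≤ E`".  The shape
is monotone in `E`; below `E = 3/(4π)` it is refuted.  (No named `def` for the shape: the statements carry
it inline so that this file stays a pure-proof file.) -/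

/-- **No level below `3/(4π)`** (refutation of the natural strengthening "light := lighter than
`3/(4π) ≈ 0.2387`" of `LightSteadyStatesGP`; the crux itself is the case `E = 2`): along `ν_j → 0` the
floor `3/2 ≤ (2π + 2π²ν_j)∫|u_j|² + 3π²ν_j` forces `∫|u_j|² ≥ 3/(4π) − o(1)`.  The mean-zero clause of the
witnesses is not used. [folklore] -/
theorem not_lightSteadyStatesGP_atLevel_of_lt {E : ℝ} (hE : E < 3 / (4 * Real.pi)) :
    ¬ ∃ (ν : ℕ → ℝ) (u : ℕ → UnitAddTorus (Fin 3) → EuclideanSpace ℝ (Fin 3)) (p : ℕ → UnitAddTorus (Fin 3) → ℝ), (∀ j, 0 < ν j ∧ ν j ≤ 1) ∧ Filter.Tendsto ν Filter.atTop (nhds 0) ∧ (∀ j, Literature.Analysis.FunctionSpaces.Torus.IsClassicalNSSolutionOn Set.univ (ν j) (fun _ => fun x : UnitAddTorus (Fin 3) => (Literature.Analysis.FluidPDE.Torus.stokesMode (Pi.single (2 : Fin 3) (1 : ℤ)) (EuclideanSpace.single (0 : Fin 3) (1 : ℝ)) false x + Literature.Analysis.FluidPDE.Torus.stokesMode (Pi.single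 (0 : Fin 3) (1 : ℤ)) (EuclideanSpace.single (1 : Fin 3) (1 : ℝ)) false x + Literature.Analysis.FluidPDE.Torus.stokesMode (Pi.single (1 : Fin 3) (1 : ℤ)) (EuclideanSpace.single (2 : Fin 3) (1 : ℝ)) false x : EuclideanSpace ℝ (Fin 3))) (fun _ => u j) (fun _ => p j)) ∧ (∀ j, Literature.Analysis.FunctionSpaces.Torus.HasZeroMean (u j)) ∧ ∀ j, ∫ x, ‖u j x‖ ^ 2 ≤ E := by
  rintro ⟨ν, u, p, hν, hν0, hsol, -, hE'⟩
  have hπ := Real.pi_pos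
  have hgap : 0 < 3 / 2 - 2 * Real.pi * E := by
    have h3 : 2 * Real.pi * (3 / (4 * Real.pi)) = 3 / 2 := by
      field_simp
      ring
    have : 2 * Real.pi * E < 2 * Real.pi * (3 / (4 * Real.pi)) := mul_lt_mul_of_pos_left hE (by positivity)
    linarith
  have hE0 : 0 ≤ E := (integral_nonneg fun x => sq_nonneg ‖u 0 x‖).trans (hE' 0)
  set δ : ℝ := (3 / 2 - 2 * Real.pi * E) / (2 * Real.pi ^ 2 * E + 3 * Real.pi ^ 2 + 1) with hδ
  have hK : 0 < 2 * Real.pi ^ 2 * E + 3 * Real.pi ^ 2 + 1 := by positivity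
  have hδpos : 0 < δ := div_pos hgap hK
  obtain ⟨j, hj⟩ := ((tendsto_order.1 hν0).2 δ hδpos).exists
  have hνj : 0 < ν j := (hν j).1
  have hfl := floor hνj.le (hsol j)
  have h1 : (2 * Real.pi + 2 * Real.pi ^ 2 * ν j) * (∫ x, ‖u j x‖ ^ 2) ≤
      (2 * Real.pi + 2 * Real.pi ^ 2 * ν j) * E :=
    mul_le_mul_of_nonneg_left (hE' j) (by positivity)
  have h2 : ν j * (2 * Real.pi ^ 2 * E + 3 * Real.pi ^ 2 + 1) <
      δ * (2 * Real.pi ^ 2 * E + 3 * Real.pi ^ 2 + 1) :=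
    mul_lt_mul_of_pos_right hj hK
  have h3 : δ * (2 * Real.pi ^ 2 * E + 3 * Real.pi ^ 2 + 1) = 3 / 2 - 2 * Real.pi * E := by
    rw [hδ]
    field_simp
  nlinarith [h1, h2, h3, hfl, hνj]

/-- Equivalently: every level `E` at which the shape of the crux holds is at least `3/(4π)`; the pinned
level `2` of `LightSteadyStatesGP` clears it by the factor `8π/3`. [folklore] -/
theorem level_ge_of_lightSteadyStatesGP_atLevel {E : ℝ}
    (h : ∃ (ν : ℕ → ℝ) (u : ℕ → UnitAddTorus (Fin 3) → EuclideanSpace ℝ (Fin 3)) (p : ℕ → UnitAddTorus (Fin 3) → ℝ), (∀ j, 0 < ν j ∧ ν j ≤ 1) ∧ Filter.Tendsto ν Filter.atTop (nhds 0) ∧ (∀ j, Literature.Analysis.FunctionSpaces.Torus.IsClassicalNSSolutionOn Set.univ (ν j) (fun _ => fun x : UnitAddTorus (Fin 3) => (Literature.Analysis.FluidPDE.Torus.stokesMode (Pi.single (2 : Fin 3) (1 : ℤ)) (EuclideanSpace.single (0 : Fin 3) (1 : ℝ)) false x + Literature.Analysis.FluidPDE.Torus.stokesMode (Pi.single (0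 : Fin 3) (1 : ℤ)) (EuclideanSpace.single (1 : Fin 3) (1 : ℝ)) false x + Literature.Analysis.FluidPDE.Torus.stokesMode (Pi.single (1 : Fin 3) (1 : ℤ)) (EuclideanSpace.single (2 : Fin 3) (1 : ℝ)) false x : EuclideanSpace ℝ (Fin 3))) (fun _ => u j) (fun _ => p j)) ∧ (∀ j, Literature.Analysis.FunctionSpaces.Torus.HasZeroMean (u j)) ∧ ∀ j, ∫ x, ‖u j x‖ ^ 2 ≤ E) :
    3 / (4 * Real.pi) ≤ E :=
  not_lt.1 fun hE => not_lightSteadyStatesGP_atLevel_of_lt hE h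

/-- Concrete instance: the shape of the crux fails at level `1/5` (`1/5 < 3/(4π)` as `π < 15/4`). [folklore] -/
theorem not_lightSteadyStatesGP_atLevel_fifth :
    ¬ ∃ (ν : ℕ → ℝ) (u : ℕ → UnitAddTorus (Fin 3) → EuclideanSpace ℝ (Fin 3)) (p : ℕ → UnitAddTorus (Fin 3) → ℝ), (∀ j, 0 < ν j ∧ ν j ≤ 1) ∧ Filter.Tendsto ν Filter.atTop (nhds 0) ∧ (∀ j, Literature.Analysis.FunctionSpaces.Torus.IsClassicalNSSolutionOn Set.univ (ν j) (fun _ => fun x : UnitAddTorus (Fin 3) => (Literature.Analysis.FluidPDE.Torus.stokesMode (Pi.single (2 : Fin 3) (1 : ℤ)) (EuclideanSpace.single (0 : Fin 3) (1 : ℝ)) false x + Literature.Analysis.FluidPDE.Torus.stokesMode (Pi.single (0 : Fin 3) (1 : ℤ)) (EuclideanSpace.single (1 : Fin 3) (1 : ℝ)) false x + Literature.Analysis.FluidPDE.Torus.stokesMode (Pi.single (1 : Fin 3) (1 : ℤ)) (EuclideanSpace.single (2 : Fin 3) (1 : ℝ)) false x : EuclideanSpace ℝ (Fin 3))) (fun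 _ => u j) (fun _ => p j)) ∧ (∀ j, Literature.Analysis.FunctionSpaces.Torus.HasZeroMean (u j)) ∧ ∀ j, ∫ x, ‖u j x‖ ^ 2 ≤ 1 / 5 := by
  refine not_lightSteadyStatesGP_atLevel_of_lt ?_
  rw [lt_div_iff₀ (by positivity)]
  nlinarith [Real.pi_lt_d2]

/-! ## §5 The energy–dissipation window of the crux's own witnesses -/

/-- **Every witness slice of `LightSteadyStatesGP` lives in the shell**
`(3/2 − 3π²ν_j)/(2π + 2π²ν_j) ≤ ∫|u_j|² ≤ 2` **and dissipates at most `√3`**: stated on the conjuncts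
of the crux (force inline). [folklore] -/
theorem witness_window {ν : ℝ} {u : UnitAddTorus (Fin 3) → EuclideanSpace ℝ (Fin 3)}
    {p : UnitAddTorus (Fin 3) → ℝ} (hν : 0 < ν)
    (h : Torus.IsClassicalNSSolutionOn Set.univ ν (fun _ => fun x : UnitAddTorus (Fin 3) => (Literature.Analysis.FluidPDE.Torus.stokesMode (Pi.single (2 : Fin 3) (1 : ℤ)) (EuclideanSpace.single (0 : Fin 3) (1 : ℝ)) false x + Literature.Analysis.FluidPDE.Torus.stokesMode (Pi.single (0 : Fin 3) (1 : ℤ)) (EuclideanSpace.single (1 : Fin 3) (1 : ℝ)) false x + Literature.Analysis.FluidPDE.Torus.stokesMode (Pi.single (1 : Fin 3) (1 : ℤ)) (EuclideanSpace.single (2 : Fin 3) (1 : ℝ)) false x : EuclideanSpace ℝ (Fin 3))) (fun _ => u) (fun _ => p))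
    (hE : ∫ x, ‖u x‖ ^ 2 ≤ 2) :
    (3 / 2 - 3 * Real.pi ^ 2 * ν) / (2 * Real.pi + 2 * Real.pi ^ 2 * ν) ≤ ∫ x, ‖u x‖ ^ 2 ∧
      (ν * Torus.gradNormSq u) ^ 2 ≤ 3 := by
  refine ⟨?_, dissipation_sq_le_of_light h hE⟩
  rw [div_le_iff₀ (by positivity)]
  have := floor hν.le h
  linarith

/-- **What every witness of `LightSteadyStatesGP` looks like** (a consequence of the crux, not a proof of
it): along its sequence `ν_j → 0` each slice is a classical steady state in the energy shell
`[(3/2 − 3π²ν_j)/(2π + 2π²ν_j), 2]` with dissipation `ν_j‖∇u_j‖₂² ≤ √3` — bounded virtual dissipation, so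
(with the sibling crux `LambRigidGP`) loud-and-light, never loud-and-heavy or quiet-and-small. [folklore] -/
theorem lightSteadyStatesGP_witness_shell
    (h : Summit.AnomalousDissipation.AnomalousDissipation.Theses.VirtualDissipation.LightSteadyStatesGP) :
    ∃ (ν : ℕ → ℝ) (u : ℕ → UnitAddTorus (Fin 3) → EuclideanSpace ℝ (Fin 3)),
      Filter.Tendsto ν Filter.atTop (nhds 0) ∧ ∀ j, 0 < ν j ∧
        (3 / 2 - 3 * Real.pi ^ 2 * ν j) / (2 * Real.pi + 2 * Real.pi ^ 2 * ν j) ≤ ∫ x, ‖u j x‖ ^ 2 ∧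
        ∫ x, ‖u j x‖ ^ 2 ≤ 2 ∧ (ν j * Torus.gradNormSq (u j)) ^ 2 ≤ 3 := by
  obtain ⟨ν, u, p, hν, hν0, hsol, -, hE⟩ := h
  refine ⟨ν, u, hν0, fun j => ⟨(hν j).1, ?_⟩⟩
  obtain ⟨h1, h2⟩ := witness_window (hν j).1 (hsol j) (hE j)
  exact ⟨h1, hE j, h2⟩

end Summit.AnomalousDissipation.AnomalousDissipation.Theorems.LightSteadyStatesGP.Negative.LevelFloor

end
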